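import Summits.CriticalPhenomena.PercolationContinuityZ3.Theorems.PercNearOneGluingNoHeavyLowerTailSahiOneStepProfileGridOrStepPieces
import HarnessLib

/-!
# THE OR-CYLINDER STEP for `(2′)` — part 3/3: assembly `gridK_orStep`

Prover prim-ineq-prove-3 gen 45 (`--supports stmt-CriticalPhenomena-4575`; memo
`run/shared/lean/prim/prim-ineq-prove-3/PROOF-G45-CHAIN-RULE.md` §5).  Uses `…ProfileGridOrStepPrelim` (two-piece identity
`orStep_arith`, abstract fibre lemmas `orStep_T_of_S1`, `orStep_M1_fibre`, `orStep_M2_fibre`), `…ProfileGridOrStepFibre` (point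
restriction, `ball_mono_fibre`) and `…ProfileGridOrStepAtoms` (`fibre_factor`, `fibre_monA`, `fibre_monZ`).

**`gridK_orStep`.**  `φ_j` `PF₂` weights on `{0,…,N}` (not normalised), `Φ = Π φ_j`, slot `{Σ_j v_j ≥ t}`; `i` a coordinate, `c` a cut,
`C` an event NOT depending on `v_i`; `u` a numerator with `0 ≤ u ≤ Φ` and the one-coordinate cross inequalities.  HYPOTHESES, in the
homogeneous cubic form `K̃` of `…ProfileGridChainRule`: (H0) `K̃ ≥ 0` for the LOW piece (`φ_i` restricted to `{n < c}`, numerator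
`u·1[v_i < c]`) against `C` at slot `t`; (H1) `K̃ ≥ 0` for every POINT piece `v_i = y`, `c ≤ y ≤ N` (numerator `u·1[v_i = y]`) against `C`
at every shifted slot `t + y − x`, `x < c`.  CONCLUSION: `K̃(Φ, u; {c ≤ v_i} ∪ C) ≥ 0` at slot `t`.
THIS FILE: the assembly.
PROOF = memo §5: the eleven atoms of the two pieces, `M̃₁ = Σ_{x<c} m_x` with `m_x ≥ 0` (`orStep_M1_fibre`, fed by `(S1′)` = (H1) in complement
form transported to the fibre `x`, ball monotonicity and the two chain monotonicities), `M̃₂' = Σ_{y≥c} n_y` with `n_y ≥ 0`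
(`orStep_M2_fibre`), and `orStep_arith`.  No definitions, no sorries.
-/

noncomputable section

namespace Summit.CriticalPhenomena.PercolationContinuityZ3.Theorems

namespace SahiOneStep

namespace ProfileGrid

open Finset Function
open Literature.Probability.Distributions (IsLogConcaveSeq piWeight blockSum)
open scoped Classical

variable {κ : Type*} [Fintype κ] [DecidableEq κ] {N : ℕ}
/-! ## THE OR-STEP -/

/-- **THE OR-CYLINDER STEP (homogeneous form).**  See the module docstring. [this work] -/
theorem gridK_orStep (φ : κ → ℕ → ℝ) (hφ : ∀ j, IsLogConcaveSeq (φ j)) (i : κ) (c t : ℕ)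
    (PC : (κ → Fin (N + 1)) → Prop) [DecidablePred PC] (hPCi : ∀ v k, PC (update v i k) ↔ PC v)
    (u : (κ → Fin (N + 1)) → ℝ) (hu0 : ∀ v, 0 ≤ u v) (huΦ : ∀ v, u v ≤ piWeight N φ v)
    (hmono : ∀ v j (x x' : Fin (N + 1)), x ≤ x' → u (update v j x) * φ j x' ≤ u (update v j x') * φ j x)
    (H0 : 0 ≤ (∑ v : κ → Fin (N + 1), piWeight N (update φ i (fun n => if n < c then φ i n else 0)) v) *
          (∑ v : κ → Fin (N + 1), if ¬ t ≤ blockSum univ v then piWeight N (update φ i (fun n => if n < c then φ i n else 0)) v else 0) *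
          (∑ v : κ → Fin (N + 1), if t ≤ blockSum univ v ∧ PC v then (if (v i : ℕ) < c then u v else 0) else 0)
        + (∑ v : κ → Fin (N + 1), piWeight N (update φ i (fun n => if n < c then φ i n else 0)) v) *
          (∑ v : κ → Fin (N + 1), if ¬ t ≤ blockSum univ v then (if (v i : ℕ) < c then u v else 0) else 0) *
          (∑ v : κ → Fin (N + 1), if PC v ∧ ¬ t ≤ blockSum univ v then piWeight N (update φ i (fun n => if n < c then φ i n else 0)) v else 0)
        - (∑ v : κ → Fin (N + 1), if ¬ t ≤ blockSum univ v then piWeight N (update φ i (fun n => if n < c then φ i n else 0)) v else 0) *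
          (∑ v : κ → Fin (N + 1), (if (v i : ℕ) < c then u v else 0)) *
          (∑ v : κ → Fin (N + 1), if PC v then piWeight N (update φ i (fun n => if n < c then φ i n else 0)) v else 0))
    (H1 : ∀ x y : ℕ, x < c → c ≤ y → y ≤ N →
      0 ≤ (∑ v : κ → Fin (N + 1), piWeight N (update φ i (fun n => if n = y then φ i n else 0)) v) *
          (∑ v : κ → Fin (N + 1), if ¬ t + y - x ≤ blockSum univ v then
            piWeight N (update φ i (fun n => if n = y then φ i n else 0)) v else 0) *
          (∑ v : κ → Fin (N + 1), if t + y - x ≤ blockSum univ v ∧ PC v then (if (v i : ℕ) = y then u v else 0) else 0)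
        + (∑ v : κ → Fin (N + 1), piWeight N (update φ i (fun n => if n = y then φ i n else 0)) v) *
          (∑ v : κ → Fin (N + 1), if ¬ t + y - x ≤ blockSum univ v then (if (v i : ℕ) = y then u v else 0) else 0) *
          (∑ v : κ → Fin (N + 1), if PC v ∧ ¬ t + y - x ≤ blockSum univ v then
            piWeight N (update φ i (fun n => if n = y then φ i n else 0)) v else 0)
        - (∑ v : κ → Fin (N + 1), if ¬ t + y - x ≤ blockSum univ v then
            piWeight N (update φ i (fun n => if n = y then φ i n else 0)) v else 0) *
          (∑ v : κ → Fin (N + 1), (if (v i : ℕ) = y then u v else 0)) *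
          (∑ v : κ → Fin (N + 1), if PC v then piWeight N (update φ i (fun n => if n = y then φ i n else 0)) v else 0)) :
    0 ≤ (∑ v : κ → Fin (N + 1), piWeight N φ v) * (∑ v : κ → Fin (N + 1), if ¬ t ≤ blockSum univ v then piWeight N φ v else 0) *
          (∑ v : κ → Fin (N + 1), if t ≤ blockSum univ v ∧ (c ≤ (v i : ℕ) ∨ PC v) then u v else 0)
        + (∑ v : κ → Fin (N + 1), piWeight N φ v) * (∑ v : κ → Fin (N + 1), if ¬ t ≤ blockSum univ v then u v else 0) *
          (∑ v : κ → Fin (N + 1), if (c ≤ (v i : ℕ) ∨ PC v) ∧ ¬ t ≤ blockSum univ v then piWeight N φ v else 0)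
        - (∑ v : κ → Fin (N + 1), if ¬ t ≤ blockSum univ v then piWeight N φ v else 0) * (∑ v : κ → Fin (N + 1), u v) *
          (∑ v : κ → Fin (N + 1), if (c ≤ (v i : ℕ) ∨ PC v) then piWeight N φ v else 0) := by
  have hφ0 : ∀ j n, 0 ≤ φ j n := fun j => (hφ j).1
  have hw0 : ∀ v, 0 ≤ piWeight N φ v := fun v => piWeight_nonneg hφ0 v
  obtain ⟨a, ha, -, hua⟩ := exists_monotone_density hφ0 u hu0 huΦ hmono
  -- the pieces of the goal sums
  have G1 : (∑ v : κ → Fin (N + 1), piWeight N φ v) = (∑ v : κ → Fin (N + 1), if c ≤ (v i : ℕ) then piWeight N φ v else 0) +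
      ∑ v : κ → Fin (N + 1), if ¬ c ≤ (v i : ℕ) then piWeight N φ v else 0 := sum_split _ _
  have G2 : (∑ v : κ → Fin (N + 1), if ¬ t ≤ blockSum univ v then piWeight N φ v else 0) =
      (∑ v : κ → Fin (N + 1), if c ≤ (v i : ℕ) ∧ ¬ t ≤ blockSum univ v then piWeight N φ v else 0) +
      ∑ v : κ → Fin (N + 1), if ¬ c ≤ (v i : ℕ) ∧ ¬ t ≤ blockSum univ v then piWeight N φ v else 0 := by
    rw [← sum_add_distrib]
    exact sum_congr rfl fun v _ => by by_cases h1 : c ≤ (v i : ℕ) <;> by_cases h2 : t ≤ blockSum univ v <;> simp [h1, h2]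
  have G3 : (∑ v : κ → Fin (N + 1), if t ≤ blockSum univ v ∧ (c ≤ (v i : ℕ) ∨ PC v) then u v else 0) =
      (∑ v : κ → Fin (N + 1), if c ≤ (v i : ℕ) ∧ t ≤ blockSum univ v then u v else 0) +
      ∑ v : κ → Fin (N + 1), if ¬ c ≤ (v i : ℕ) ∧ (PC v ∧ t ≤ blockSum univ v) then u v else 0 := by
    rw [← sum_add_distrib]
    exact sum_congr rfl fun v _ => by
      by_cases h1 : c ≤ (v i : ℕ) <;> by_cases h2 : t ≤ blockSum univ v <;> by_cases h3 : PC v <;> simp [h1, h2, h3]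
  have G4 : (∑ v : κ → Fin (N + 1), if ¬ t ≤ blockSum univ v then u v else 0) =
      (∑ v : κ → Fin (N + 1), if c ≤ (v i : ℕ) ∧ ¬ t ≤ blockSum univ v then u v else 0) +
      ∑ v : κ → Fin (N + 1), if ¬ c ≤ (v i : ℕ) ∧ ¬ t ≤ blockSum univ v then u v else 0 := by
    rw [← sum_add_distrib]
    exact sum_congr rfl fun v _ => by by_cases h1 : c ≤ (v i : ℕ) <;> by_cases h2 : t ≤ blockSum univ v <;> simp [h1, h2]
  have G5 : (∑ v : κ → Fin (N + 1), if (c ≤ (v i : ℕ) ∨ PC v) ∧ ¬ t ≤ blockSum univ v then piWeight N φ v else 0) =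
      (∑ v : κ → Fin (N + 1), if c ≤ (v i : ℕ) ∧ ¬ t ≤ blockSum univ v then piWeight N φ v else 0) +
      ∑ v : κ → Fin (N + 1), if ¬ c ≤ (v i : ℕ) ∧ (PC v ∧ ¬ t ≤ blockSum univ v) then piWeight N φ v else 0 := by
    rw [← sum_add_distrib]
    exact sum_congr rfl fun v _ => by
      by_cases h1 : c ≤ (v i : ℕ) <;> by_cases h2 : t ≤ blockSum univ v <;> by_cases h3 : PC v <;> simp [h1, h2, h3]
  have G6 : (∑ v : κ → Fin (N + 1), u v) = (∑ v : κ → Fin (N + 1), if c ≤ (v i : ℕ) ∧ t ≤ blockSum univ v then u v else 0) +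
      (∑ v : κ → Fin (N + 1), if c ≤ (v i : ℕ) ∧ ¬ t ≤ blockSum univ v then u v else 0) +
      ∑ v : κ → Fin (N + 1), if ¬ c ≤ (v i : ℕ) then u v else 0 := by
    rw [← sum_add_distrib, ← sum_add_distrib]
    exact sum_congr rfl fun v _ => by by_cases h1 : c ≤ (v i : ℕ) <;> by_cases h2 : t ≤ blockSum univ v <;> simp [h1, h2]
  have G7 : (∑ v : κ → Fin (N + 1), if (c ≤ (v i : ℕ) ∨ PC v) then piWeight N φ v else 0) =
      (∑ v : κ → Fin (N + 1), if c ≤ (v i : ℕ) then piWeight N φ v else 0) +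
      ∑ v : κ → Fin (N + 1), if ¬ c ≤ (v i : ℕ) ∧ PC v then piWeight N φ v else 0 := by
    rw [← sum_add_distrib]
    exact sum_congr rfl fun v _ => by by_cases h1 : c ≤ (v i : ℕ) <;> by_cases h3 : PC v <;> simp [h1, h3]
  rw [G1, G2, G3, G4, G5, G6, G7]
  -- (H0) in atoms
  simp only [piWeight_update_truncLT] at H0
  have K1 : (∑ v : κ → Fin (N + 1), if (v i : ℕ) < c then piWeight N φ v else 0) =
      ∑ v : κ → Fin (N + 1), if ¬ c ≤ (v i : ℕ) then piWeight N φ v else 0 := sum_congr rfl fun v _ => by simp only [Nat.not_le]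
  have K2 : (∑ v : κ → Fin (N + 1), if ¬ t ≤ blockSum univ v then (if (v i : ℕ) < c then piWeight N φ v else 0) else 0) =
      ∑ v : κ → Fin (N + 1), if ¬ c ≤ (v i : ℕ) ∧ ¬ t ≤ blockSum univ v then piWeight N φ v else 0 :=
    sum_congr rfl fun v _ => by by_cases h1 : (v i : ℕ) < c <;> by_cases h2 : t ≤ blockSum univ v <;> simp [h1, h2, not_le]
  have K3 : (∑ v : κ → Fin (N + 1), if t ≤ blockSum univ v ∧ PC v then (if (v i : ℕ) < c then u v else 0) else 0) =
      ∑ v : κ → Fin (N + 1), if ¬ c ≤ (v i : ℕ) ∧ (PC v ∧ t ≤ blockSum univ v) then u v else 0 :=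
    sum_congr rfl fun v _ => by
      by_cases h1 : (v i : ℕ) < c <;> by_cases h2 : t ≤ blockSum univ v <;> by_cases h3 : PC v <;> simp [h1, h2, h3, not_le]
  have K4 : (∑ v : κ → Fin (N + 1), if ¬ t ≤ blockSum univ v then (if (v i : ℕ) < c then u v else 0) else 0) =
      ∑ v : κ → Fin (N + 1), if ¬ c ≤ (v i : ℕ) ∧ ¬ t ≤ blockSum univ v then u v else 0 :=
    sum_congr rfl fun v _ => by by_cases h1 : (v i : ℕ) < c <;> by_cases h2 : t ≤ blockSum univ v <;> simp [h1, h2, not_le]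
  have K5 : (∑ v : κ → Fin (N + 1), if PC v ∧ ¬ t ≤ blockSum univ v then (if (v i : ℕ) < c then piWeight N φ v else 0) else 0) =
      ∑ v : κ → Fin (N + 1), if ¬ c ≤ (v i : ℕ) ∧ (PC v ∧ ¬ t ≤ blockSum univ v) then piWeight N φ v else 0 :=
    sum_congr rfl fun v _ => by
      by_cases h1 : (v i : ℕ) < c <;> by_cases h2 : t ≤ blockSum univ v <;> by_cases h3 : PC v <;> simp [h1, h2, h3, not_le]
  have K6 : (∑ v : κ → Fin (N + 1), if (v i : ℕ) < c then u v else 0) = ∑ v : κ → Fin (N + 1), if ¬ c ≤ (v i : ℕ) then u v else 0 :=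
    sum_congr rfl fun v _ => by simp only [Nat.not_le]
  have K7 : (∑ v : κ → Fin (N + 1), if PC v then (if (v i : ℕ) < c then piWeight N φ v else 0) else 0) =
      ∑ v : κ → Fin (N + 1), if ¬ c ≤ (v i : ℕ) ∧ PC v then piWeight N φ v else 0 :=
    sum_congr rfl fun v _ => by by_cases h1 : (v i : ℕ) < c <;> by_cases h3 : PC v <;> simp [h1, h3, not_le]
  rw [K1, K2, K3, K4, K5, K6, K7] at H0
  -- lo complement atoms: `Uc = A₀ − S₀ − R₀`, `Lc = L₀ − T₀`, `Zc = Z₀ − G₀`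
  have Ru : (∑ v : κ → Fin (N + 1), if ¬ c ≤ (v i : ℕ) then u v else 0) =
      (∑ v : κ → Fin (N + 1), if ¬ c ≤ (v i : ℕ) ∧ (PC v ∧ t ≤ blockSum univ v) then u v else 0) +
      (∑ v : κ → Fin (N + 1), if ¬ c ≤ (v i : ℕ) ∧ (t ≤ blockSum univ v ∧ ¬ PC v) then u v else 0) +
      ∑ v : κ → Fin (N + 1), if ¬ c ≤ (v i : ℕ) ∧ ¬ t ≤ blockSum univ v then u v else 0 := by
    rw [← sum_add_distrib, ← sum_add_distrib]
    exact sum_congr rfl fun v _ => by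
      by_cases h1 : c ≤ (v i : ℕ) <;> by_cases h2 : t ≤ blockSum univ v <;> by_cases h3 : PC v <;> simp [h1, h2, h3]
  -- `M̃₁ ≥ 0`: sum of `orStep_mx` over the low fibres
  set loS : Finset ℕ := (range (N + 1)).filter (fun x => ¬ c ≤ x) with hloS
  have loS_mem : ∀ {x}, x ∈ loS → x < c ∧ x ≤ N := fun hx => by
    rw [hloS, mem_filter, mem_range] at hx; exact ⟨not_le.1 hx.2, Nat.lt_succ_iff.1 hx.1⟩
  have dec : ∀ (E : (κ → Fin (N + 1)) → Prop) [DecidablePred E] (f : (κ → Fin (N + 1)) → ℝ),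
      (∑ v : κ → Fin (N + 1), if ¬ c ≤ (v i : ℕ) ∧ E v then f v else 0) =
        ∑ x ∈ loS, ∑ v : κ → Fin (N + 1), if (v i : ℕ) = x ∧ E v then f v else 0 := by
    intro E _ f
    have e1 : (∑ v : κ → Fin (N + 1), if ¬ c ≤ (v i : ℕ) ∧ E v then f v else 0) =
        ∑ v : κ → Fin (N + 1), if ¬ c ≤ (v i : ℕ) then (if E v then f v else 0) else 0 :=
      sum_congr rfl fun v _ => by by_cases h1 : c ≤ (v i : ℕ) <;> by_cases h2 : E v <;> simp [h1, h2]
    rw [e1, sum_fibre_filter i (fun x => ¬ c ≤ x)]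
    refine sum_congr rfl fun x _ => sum_congr rfl fun v _ => ?_
    by_cases h1 : (v i : ℕ) = x <;> by_cases h2 : E v <;> simp [h1, h2]
  have dZc : (∑ v : κ → Fin (N + 1), if ¬ c ≤ (v i : ℕ) then piWeight N φ v else 0) -
      (∑ v : κ → Fin (N + 1), if ¬ c ≤ (v i : ℕ) ∧ PC v then piWeight N φ v else 0) =
      ∑ x ∈ loS, ∑ v : κ → Fin (N + 1), if (v i : ℕ) = x ∧ ¬ PC v then piWeight N φ v else 0 := by
    rw [← dec (fun v => ¬ PC v) (fun v => piWeight N φ v), sub_eq_iff_eq_add, ← sum_add_distrib]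
    exact sum_congr rfl fun v _ => by by_cases h1 : c ≤ (v i : ℕ) <;> by_cases h2 : PC v <;> simp [h1, h2]
  have dLc : (∑ v : κ → Fin (N + 1), if ¬ c ≤ (v i : ℕ) ∧ ¬ t ≤ blockSum univ v then piWeight N φ v else 0) -
      (∑ v : κ → Fin (N + 1), if ¬ c ≤ (v i : ℕ) ∧ (PC v ∧ ¬ t ≤ blockSum univ v) then piWeight N φ v else 0) =
      ∑ x ∈ loS, ∑ v : κ → Fin (N + 1), if (v i : ℕ) = x ∧ (¬ PC v ∧ ¬ t ≤ blockSum univ v) then piWeight N φ v else 0 := by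
    rw [← dec (fun v => ¬ PC v ∧ ¬ t ≤ blockSum univ v) (fun v => piWeight N φ v), sub_eq_iff_eq_add, ← sum_add_distrib]
    exact sum_congr rfl fun v _ => by
      by_cases h1 : c ≤ (v i : ℕ) <;> by_cases h2 : PC v <;> by_cases h3 : t ≤ blockSum univ v <;> simp [h1, h2, h3]
  have dUc := dec (fun v => t ≤ blockSum univ v ∧ ¬ PC v) u
  have hmx : ∀ x ∈ loS,
      (∑ v : κ → Fin (N + 1), if c ≤ (v i : ℕ) then piWeight N φ v else 0) *
        (∑ v : κ → Fin (N + 1), if c ≤ (v i : ℕ) ∧ ¬ t ≤ blockSum univ v then piWeight N φ v else 0) *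
        (∑ v : κ → Fin (N + 1), if (v i : ℕ) = x ∧ (t ≤ blockSum univ v ∧ ¬ PC v) then u v else 0)
      + (∑ v : κ → Fin (N + 1), if c ≤ (v i : ℕ) then piWeight N φ v else 0) *
        (∑ v : κ → Fin (N + 1), if c ≤ (v i : ℕ) ∧ ¬ t ≤ blockSum univ v then u v else 0) *
        (∑ v : κ → Fin (N + 1), if (v i : ℕ) = x ∧ (¬ PC v ∧ ¬ t ≤ blockSum univ v) then piWeight N φ v else 0) ≤
      (∑ v : κ → Fin (N + 1), if c ≤ (v i : ℕ) ∧ ¬ t ≤ blockSum univ v then piWeight N φ v else 0) *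
        (∑ v : κ → Fin (N + 1), if c ≤ (v i : ℕ) then u v else 0) *
        (∑ v : κ → Fin (N + 1), if (v i : ℕ) = x ∧ ¬ PC v then piWeight N φ v else 0) := by
    intro x hx
    obtain ⟨hxc, hxN⟩ := loS_mem hx
    have h := orStep_mx φ hφ i c t PC hPCi hu0 huΦ ha hua hmono ⟨x, Nat.lt_succ_of_le hxN⟩ (by exact hxc)
      (fun y hcy hyN => H1 x y hxc hcy hyN)
    exact h
  have hM1sum := sum_le_sum hmx
  rw [sum_add_distrib, ← mul_sum, ← mul_sum, ← mul_sum, ← dZc, ← dLc, ← dUc] at hM1sum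
  -- the high-piece total `A₁ = P₁ + Q₁`
  have RA : (∑ v : κ → Fin (N + 1), if c ≤ (v i : ℕ) then u v else 0) =
      (∑ v : κ → Fin (N + 1), if c ≤ (v i : ℕ) ∧ t ≤ blockSum univ v then u v else 0) +
      ∑ v : κ → Fin (N + 1), if c ≤ (v i : ℕ) ∧ ¬ t ≤ blockSum univ v then u v else 0 := by
    rw [← sum_add_distrib]
    exact sum_congr rfl fun v _ => by by_cases h1 : c ≤ (v i : ℕ) <;> by_cases h2 : t ≤ blockSum univ v <;> simp [h1, h2]
  rw [RA] at hM1sum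
  -- `M̃₂' ≥ 0`: sum of `orStep_ny` over the high fibres
  set hiS : Finset ℕ := (range (N + 1)).filter (fun y => c ≤ y) with hhiS
  have hiS_mem : ∀ {y}, y ∈ hiS → c ≤ y ∧ y ≤ N := fun hy => by
    rw [hhiS, mem_filter, mem_range] at hy; exact ⟨hy.2, Nat.lt_succ_iff.1 hy.1⟩
  have dech : ∀ (E : (κ → Fin (N + 1)) → Prop) [DecidablePred E] (f : (κ → Fin (N + 1)) → ℝ),
      (∑ v : κ → Fin (N + 1), if c ≤ (v i : ℕ) ∧ E v then f v else 0) =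
        ∑ y ∈ hiS, ∑ v : κ → Fin (N + 1), if (v i : ℕ) = y ∧ E v then f v else 0 := by
    intro E _ f
    have e1 : (∑ v : κ → Fin (N + 1), if c ≤ (v i : ℕ) ∧ E v then f v else 0) =
        ∑ v : κ → Fin (N + 1), if c ≤ (v i : ℕ) then (if E v then f v else 0) else 0 :=
      sum_congr rfl fun v _ => by by_cases h1 : c ≤ (v i : ℕ) <;> by_cases h2 : E v <;> simp [h1, h2]
    rw [e1, sum_fibre_filter i (fun y => c ≤ y)]
    refine sum_congr rfl fun y _ => sum_congr rfl fun v _ => ?_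
    by_cases h1 : (v i : ℕ) = y <;> by_cases h2 : E v <;> simp [h1, h2]
  have hZ1 : (∑ v : κ → Fin (N + 1), if c ≤ (v i : ℕ) then piWeight N φ v else 0) =
      ∑ y ∈ hiS, ∑ v : κ → Fin (N + 1), if (v i : ℕ) = y then piWeight N φ v else 0 := sum_fibre_filter i (fun y => c ≤ y) _
  have hA1 : (∑ v : κ → Fin (N + 1), if c ≤ (v i : ℕ) then u v else 0) =
      ∑ y ∈ hiS, ∑ v : κ → Fin (N + 1), if (v i : ℕ) = y then u v else 0 := sum_fibre_filter i (fun y => c ≤ y) _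
  have hL1 := dech (fun v => ¬ t ≤ blockSum univ v) (fun v => piWeight N φ v)
  have hQ1 := dech (fun v => ¬ t ≤ blockSum univ v) u
  have hny : ∀ y ∈ hiS, 0 ≤
      (∑ v : κ → Fin (N + 1), if ¬ c ≤ (v i : ℕ) then piWeight N φ v else 0) *
          ((∑ v : κ → Fin (N + 1), if ¬ c ≤ (v i : ℕ) then piWeight N φ v else 0) -
            (∑ v : κ → Fin (N + 1), if ¬ c ≤ (v i : ℕ) ∧ PC v then piWeight N φ v else 0)) *
          (∑ v : κ → Fin (N + 1), if ¬ c ≤ (v i : ℕ) ∧ ¬ t ≤ blockSum univ v then piWeight N φ v else 0) *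
          (∑ v : κ → Fin (N + 1), if (v i : ℕ) = y then u v else 0)
        - ((∑ v : κ → Fin (N + 1), if ¬ c ≤ (v i : ℕ) then piWeight N φ v else 0) -
            (∑ v : κ → Fin (N + 1), if ¬ c ≤ (v i : ℕ) ∧ PC v then piWeight N φ v else 0)) *
          (∑ v : κ → Fin (N + 1), if ¬ c ≤ (v i : ℕ) then u v else 0) *
          ((∑ v : κ → Fin (N + 1), if ¬ c ≤ (v i : ℕ) ∧ ¬ t ≤ blockSum univ v then piWeight N φ v else 0) *
              (∑ v : κ → Fin (N + 1), if (v i : ℕ) = y then piWeight N φ v else 0) -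
            (∑ v : κ → Fin (N + 1), if ¬ c ≤ (v i : ℕ) then piWeight N φ v else 0) *
              (∑ v : κ → Fin (N + 1), if (v i : ℕ) = y ∧ ¬ t ≤ blockSum univ v then piWeight N φ v else 0))
        - (∑ v : κ → Fin (N + 1), if ¬ c ≤ (v i : ℕ) then piWeight N φ v else 0) ^ 2 *
          (∑ v : κ → Fin (N + 1), if ¬ c ≤ (v i : ℕ) ∧ (t ≤ blockSum univ v ∧ ¬ PC v) then u v else 0) *
          (∑ v : κ → Fin (N + 1), if (v i : ℕ) = y ∧ ¬ t ≤ blockSum univ v then piWeight N φ v else 0)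
        - (∑ v : κ → Fin (N + 1), if ¬ c ≤ (v i : ℕ) then piWeight N φ v else 0) ^ 2 *
          ((∑ v : κ → Fin (N + 1), if ¬ c ≤ (v i : ℕ) ∧ ¬ t ≤ blockSum univ v then piWeight N φ v else 0) -
            (∑ v : κ → Fin (N + 1), if ¬ c ≤ (v i : ℕ) ∧ (PC v ∧ ¬ t ≤ blockSum univ v) then piWeight N φ v else 0)) *
          (∑ v : κ → Fin (N + 1), if (v i : ℕ) = y ∧ ¬ t ≤ blockSum univ v then u v else 0) := by
    intro y hy
    obtain ⟨hcy, hyN⟩ := hiS_mem hy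
    exact orStep_ny φ hφ i c t PC hPCi hu0 huΦ ha hua hmono hcy hyN (fun x hxc => H1 x y hxc hcy hyN)
  have hM2sum := sum_nonneg hny
  -- generalize the atoms
  have bL0 : (∑ v : κ → Fin (N + 1), if ¬ c ≤ (v i : ℕ) ∧ ¬ t ≤ blockSum univ v then piWeight N φ v else 0) ≤
      ∑ v : κ → Fin (N + 1), if ¬ c ≤ (v i : ℕ) then piWeight N φ v else 0 := sum_ite_le_of_imp hw0 fun v hv => hv.1
  have bG0 : (∑ v : κ → Fin (N + 1), if ¬ c ≤ (v i : ℕ) ∧ PC v then piWeight N φ v else 0) ≤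
      ∑ v : κ → Fin (N + 1), if ¬ c ≤ (v i : ℕ) then piWeight N φ v else 0 := sum_ite_le_of_imp hw0 fun v hv => hv.1
  have bT0 : (∑ v : κ → Fin (N + 1), if ¬ c ≤ (v i : ℕ) ∧ (PC v ∧ ¬ t ≤ blockSum univ v) then piWeight N φ v else 0) ≤
      ∑ v : κ → Fin (N + 1), if ¬ c ≤ (v i : ℕ) ∧ PC v then piWeight N φ v else 0 :=
    sum_ite_le_of_imp hw0 fun v hv => ⟨hv.1, hv.2.1⟩
  have bA0 : (∑ v : κ → Fin (N + 1), if ¬ c ≤ (v i : ℕ) then u v else 0) ≤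
      ∑ v : κ → Fin (N + 1), if ¬ c ≤ (v i : ℕ) then piWeight N φ v else 0 := sum_ite_le_of_le huΦ _
  have bS0 : (∑ v : κ → Fin (N + 1), if ¬ c ≤ (v i : ℕ) ∧ ¬ t ≤ blockSum univ v then u v else 0) ≤
      ∑ v : κ → Fin (N + 1), if ¬ c ≤ (v i : ℕ) then u v else 0 := sum_ite_le_of_imp hu0 fun v hv => hv.1
  have bR0 : (∑ v : κ → Fin (N + 1), if ¬ c ≤ (v i : ℕ) ∧ (PC v ∧ t ≤ blockSum univ v) then u v else 0) ≤
      ∑ v : κ → Fin (N + 1), if ¬ c ≤ (v i : ℕ) then u v else 0 := sum_ite_le_of_imp hu0 fun v hv => hv.1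
  have n1 : 0 ≤ ∑ v : κ → Fin (N + 1), if ¬ c ≤ (v i : ℕ) then piWeight N φ v else 0 := sum_ite_nonneg' hw0 _
  have n2 : 0 ≤ ∑ v : κ → Fin (N + 1), if ¬ c ≤ (v i : ℕ) ∧ ¬ t ≤ blockSum univ v then piWeight N φ v else 0 := sum_ite_nonneg' hw0 _
  have n3 : 0 ≤ ∑ v : κ → Fin (N + 1), if ¬ c ≤ (v i : ℕ) ∧ PC v then piWeight N φ v else 0 := sum_ite_nonneg' hw0 _
  have n4 : 0 ≤ ∑ v : κ → Fin (N + 1), if ¬ c ≤ (v i : ℕ) ∧ (PC v ∧ ¬ t ≤ blockSum univ v) then piWeight N φ v else 0 :=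
    sum_ite_nonneg' hw0 _
  have n5 : 0 ≤ ∑ v : κ → Fin (N + 1), if ¬ c ≤ (v i : ℕ) then u v else 0 := sum_ite_nonneg' hu0 _
  have n6 : 0 ≤ ∑ v : κ → Fin (N + 1), if ¬ c ≤ (v i : ℕ) ∧ ¬ t ≤ blockSum univ v then u v else 0 := sum_ite_nonneg' hu0 _
  have n7 : 0 ≤ ∑ v : κ → Fin (N + 1), if ¬ c ≤ (v i : ℕ) ∧ (PC v ∧ t ≤ blockSum univ v) then u v else 0 := sum_ite_nonneg' hu0 _
  have n8 : 0 ≤ ∑ v : κ → Fin (N + 1), if c ≤ (v i : ℕ) then piWeight N φ v else 0 := sum_ite_nonneg' hw0 _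
  -- rewrite the fibre sums in `hM2sum` into atoms
  have hM2 : 0 ≤ ∑ y ∈ hiS, ((∑ v : κ → Fin (N + 1), if ¬ c ≤ (v i : ℕ) then piWeight N φ v else 0) *
          ((∑ v : κ → Fin (N + 1), if ¬ c ≤ (v i : ℕ) then piWeight N φ v else 0) -
            (∑ v : κ → Fin (N + 1), if ¬ c ≤ (v i : ℕ) ∧ PC v then piWeight N φ v else 0)) *
          (∑ v : κ → Fin (N + 1), if ¬ c ≤ (v i : ℕ) ∧ ¬ t ≤ blockSum univ v then piWeight N φ v else 0) *
          (∑ v : κ → Fin (N + 1), if (v i : ℕ) = y then u v else 0)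
        + (-(((∑ v : κ → Fin (N + 1), if ¬ c ≤ (v i : ℕ) then piWeight N φ v else 0) -
            (∑ v : κ → Fin (N + 1), if ¬ c ≤ (v i : ℕ) ∧ PC v then piWeight N φ v else 0)) *
          (∑ v : κ → Fin (N + 1), if ¬ c ≤ (v i : ℕ) then u v else 0) *
          (∑ v : κ → Fin (N + 1), if ¬ c ≤ (v i : ℕ) ∧ ¬ t ≤ blockSum univ v then piWeight N φ v else 0))) *
          (∑ v : κ → Fin (N + 1), if (v i : ℕ) = y then piWeight N φ v else 0)
        + (((∑ v : κ → Fin (N + 1), if ¬ c ≤ (v i : ℕ) then piWeight N φ v else 0) -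
            (∑ v : κ → Fin (N + 1), if ¬ c ≤ (v i : ℕ) ∧ PC v then piWeight N φ v else 0)) *
          (∑ v : κ → Fin (N + 1), if ¬ c ≤ (v i : ℕ) then u v else 0) *
          (∑ v : κ → Fin (N + 1), if ¬ c ≤ (v i : ℕ) then piWeight N φ v else 0) -
          (∑ v : κ → Fin (N + 1), if ¬ c ≤ (v i : ℕ) then piWeight N φ v else 0) ^ 2 *
          (∑ v : κ → Fin (N + 1), if ¬ c ≤ (v i : ℕ) ∧ (t ≤ blockSum univ v ∧ ¬ PC v) then u v else 0)) *
          (∑ v : κ → Fin (N + 1), if (v i : ℕ) = y ∧ ¬ t ≤ blockSum univ v then piWeight N φ v else 0)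
        + (-((∑ v : κ → Fin (N + 1), if ¬ c ≤ (v i : ℕ) then piWeight N φ v else 0) ^ 2 *
          ((∑ v : κ → Fin (N + 1), if ¬ c ≤ (v i : ℕ) ∧ ¬ t ≤ blockSum univ v then piWeight N φ v else 0) -
            (∑ v : κ → Fin (N + 1), if ¬ c ≤ (v i : ℕ) ∧ (PC v ∧ ¬ t ≤ blockSum univ v) then piWeight N φ v else 0)))) *
          (∑ v : κ → Fin (N + 1), if (v i : ℕ) = y ∧ ¬ t ≤ blockSum univ v then u v else 0)) := by
    refine hM2sum.trans (le_of_eq (sum_congr rfl fun y _ => by ring))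
  rw [sum_add_distrib, sum_add_distrib, sum_add_distrib, ← mul_sum, ← mul_sum, ← mul_sum, ← mul_sum, ← hZ1, ← hA1, ← hL1, ← hQ1]
    at hM2
  rw [RA] at hM2
  clear hmx hny hM2sum dec dech dZc dLc dUc hZ1 hA1 hL1 hQ1 G1 G2 G3 G4 G5 G6 G7 K1 K2 K3 K4 K5 K6 K7 RA H1 loS_mem hiS_mem
  generalize (∑ v : κ → Fin (N + 1), if c ≤ (v i : ℕ) then piWeight N φ v else 0) = Z1 at H0 hM1sum hM2 n8 ⊢
  generalize (∑ v : κ → Fin (N + 1), if c ≤ (v i : ℕ) ∧ ¬ t ≤ blockSum univ v then piWeight N φ v else 0) = L1 at H0 hM1sum hM2 ⊢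
  generalize (∑ v : κ → Fin (N + 1), if c ≤ (v i : ℕ) ∧ t ≤ blockSum univ v then u v else 0) = P1 at H0 hM1sum hM2 ⊢
  generalize (∑ v : κ → Fin (N + 1), if c ≤ (v i : ℕ) ∧ ¬ t ≤ blockSum univ v then u v else 0) = Q1 at H0 hM1sum hM2 ⊢
  generalize (∑ v : κ → Fin (N + 1), if ¬ c ≤ (v i : ℕ) then piWeight N φ v else 0) = Z0 at H0 hM1sum hM2 bL0 bG0 bA0 n1 ⊢
  generalize (∑ v : κ → Fin (N + 1), if ¬ c ≤ (v i : ℕ) ∧ ¬ t ≤ blockSum univ v then piWeight N φ v else 0) = L0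
    at H0 hM1sum hM2 bL0 n2 ⊢
  generalize (∑ v : κ → Fin (N + 1), if ¬ c ≤ (v i : ℕ) ∧ PC v then piWeight N φ v else 0) = G0 at H0 hM1sum hM2 bG0 bT0 n3 ⊢
  generalize (∑ v : κ → Fin (N + 1), if ¬ c ≤ (v i : ℕ) ∧ (PC v ∧ ¬ t ≤ blockSum univ v) then piWeight N φ v else 0) = T0
    at H0 hM1sum hM2 bT0 n4 ⊢
  generalize (∑ v : κ → Fin (N + 1), if ¬ c ≤ (v i : ℕ) then u v else 0) = A0 at H0 hM1sum hM2 bA0 bS0 bR0 n5 Ru ⊢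
  generalize (∑ v : κ → Fin (N + 1), if ¬ c ≤ (v i : ℕ) ∧ ¬ t ≤ blockSum univ v then u v else 0) = S0 at H0 hM1sum hM2 bS0 n6 Ru ⊢
  generalize (∑ v : κ → Fin (N + 1), if ¬ c ≤ (v i : ℕ) ∧ (PC v ∧ t ≤ blockSum univ v) then u v else 0) = R0 at H0 hM1sum hM2 bR0 n7 Ru ⊢
  generalize (∑ v : κ → Fin (N + 1), if ¬ c ≤ (v i : ℕ) ∧ (t ≤ blockSum univ v ∧ ¬ PC v) then u v else 0) = Uc at hM1sum hM2 Ru ⊢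
  have hM1 : 0 ≤ L1 * (P1 + Q1) * (Z0 - G0) + Z1 * (L1 * R0 + L0 * P1 + Q1 * T0 + S0 * L1 - L1 * A0 - L0 * (P1 + Q1)) := by
    rw [Ru]; linarith [hM1sum]
  have hM2' : 0 ≤ L0 * P1 * Z0 ^ 2 - L0 * G0 * (P1 + Q1) * Z0 - L0 * (Z0 - G0) * A0 * Z1 + L1 * Z0 ^ 2 * (R0 + S0)
      - L1 * Z0 * G0 * A0 + Q1 * T0 * Z0 ^ 2 := by
    rw [Ru] at hM2 ⊢; linarith [hM2]
  have key := orStep_arith (Z₁ := Z1) (L₁ := L1) (P₁ := P1) (Q₁ := Q1) (Z₀ := Z0) (L₀ := L0) (G₀ := G0) (T₀ := T0)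
    (A₀ := A0) (S₀ := S0) (R₀ := R0) n1 n2 bL0 n3 bG0 n4 bT0 n5 bA0 n6 bS0 n7 bR0 H0 hM1 hM2' n8
  linarith [key]

end ProfileGrid

end SahiOneStep

end Summit.CriticalPhenomena.PercolationContinuityZ3.Theorems
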